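import Summits.CriticalPhenomena.PercolationContinuityZ3.Theorems.PercNearOneGluingNoHeavyQuantLongTailQuintHubRoute
import Summits.CriticalPhenomena.PercolationContinuityZ3.Theorems.PercNearOneGluingNoHeavyQuantLongTailQuintHubMasses
import Summits.CriticalPhenomena.PercolationContinuityZ3.Theorems.PercNearOneGluingNoHeavyQuantLongTailQuadHub
import HarnessLib

/-!
# QUANT lane R8, T-DEC: THE LONG-TAIL QUINT HUB — the width-5 sub-floor hub `S(γ₁) ∗ ⋯ ∗ S(γ₅)` of EVERY shape `{lo, lo+K; γ}` with `2lo < K ≤ 4lo` is SDEC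
# at EVERY gate `γᵢ ≥ lo/K` and every affordable floor; hence the hubs of widths 2–5 of every shape `lo < K ≤ 4lo` (census-1 gen 35)

builds on p205010 (kernel theorem, internal audit signed; external expert review pending)

Support file (`--supports stmt-CriticalPhenomena-4575`), QUANT lane seat prim-quant-census-1 (gen 35); memo
`run/shared/lean/prim/quant/prim-quant-census-1/g35/QUADHUB-G35.md` §5.  Theorems only, standard axioms, no sorries.  The width-5 twin of
`…QuantLongTailQuadHub` (same seat): arm-1 g50's torque-cost criterion `decAt_all_of_torqueCost` / g49's `decAt_all_of_lowCeiling`, the masses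
`sHub_five_mass0..5` (`…QuantLongTailQuintHubMasses`, via gen 31's `sHub_mass_esL`), the support `sHub_struct`, and the routes `quintHub_routeOne` /
`quintHub_routeTwo` of the uniform rule `t(s) = min(⌊D/K⌋+2, 4) − s` (`D = T − 10lo`): `5lo → 5lo+2K` (`D < K`), `5lo → 5lo+3K` (`K ≤ D ≤ 2K`),
`5lo → 5lo+4K` and `5lo+K → 5lo+3K` (`D > 2K`); every far route cost-safe.  The ten capacity inequalities behind it are the closed forms of
`…QuantLongTailQuintHubAlg{A,C1,C2,E,G}` (Handelman certificates, kit j308135 / j308545) and the derived credit forms of `…QuintHubAlgK{,2}`.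
* **`sdec_sHub_five_long`** — `2lo < K ≤ 4lo`; `P = [γ₁..γ₅]` with `lo ≤ Kγᵢ`, `γᵢ < 1`, `x(lo+K) ≤ lo+Kγᵢ`; `0 < x` ⟹ **`SDEC x ((lo+K)·5) (sHub lo K P)`**;
  **`sdec_sHub_five_upTo4`** (every `lo < K ≤ 4lo`, with gen 32's `sdec_sHub_wide` for `K ≤ 2lo`); **`sdec_sHub_upToFive_upTo4`** (widths 2, 3, 4, 5).
NUMERICS (memo §5): `g35/code/exp3_width_rule.py 5` — 503 832 (hub, floor, gate) instances with a positive low, 16 shapes `2 < K/lo ≤ 4`: 0 failures of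
compatibility / capacity / cost-safety for this rule; `exp4_quint_ineqs.py` — the ten closed forms on exact gate grids, 0 failures (margins A .005 (relative,
near-one gates), B .86, C1 .80, C2 .067, D .92/.97, E .65, F .98, G .96, H .99).  gen 34's kit j305760 had found the width-5 hub numerically SDEC.

HONEST STATUS.  A core lemma (width 5); with it gen 31/32's piece expansion runs on `|P|+|L| ≤ 5` (next file: forests with ≤ 5 glued / ≤ 5 tight siblings
of one shape `lo < K ≤ 4lo`).  Widths `≥ 6` for `K > 2lo` (three lows appear at width 6), shapes `K > 4lo`, mixed-shape hubs remain; `SiblingStep`,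
`GluedDominatedMass`, `SDECConvClosed`, `FarTreeRow` OPEN; RATE class (log\*) / honest sentence of `run/shared/lean/prim/quant/README.md` unchanged.
[this work].  Nothing here is cited as a published result.  The gluing rows served [cite: KozmaNitzan2024, Conjecture 3 (p. 15)]; product measure
[cite: Grimmett1999, §1.3 p. 10].
-/

noncomputable section
open scoped BigOperators

namespace Summit.CriticalPhenomena.PercolationContinuityZ3.Theorems
namespace Quant
namespace LawDec

/-! ### The long-tail quint hub is SDEC -/

set_option maxHeartbeats 3200000 in
/-- **THE LONG-TAIL QUINT HUB IS SDEC, `2lo < K ≤ 4lo`.**  Five gates `P = [γ₁, …, γ₅]` with `lo ≤ Kγᵢ`, `γᵢ < 1`, `x(lo+K) ≤ lo + Kγᵢ`, and every floor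
`0 < x`: `SDEC x ((lo+K)·|P|) (sHub lo K P)`.  At each outer gate `a` (`T = a(5lo + KΣγᵢ)`, `y = ax`): no low for `T ≤ 10lo`; ONE low `5lo` for
`10lo < T ≤ 10lo+2K` (`quintHub_routeOne`); TWO lows `5lo → 5lo+4K`, `5lo+K → 5lo+3K` for `T > 10lo+2K` (`quintHub_routeTwo`); then the torque-cost
criterion. [this work] -/
theorem sdec_sHub_five_long (lo K : ℕ) (hloK : lo < K) (hK2 : 2 * lo < K) (hK8 : K ≤ 4 * lo) {x : ℝ} (hx0 : 0 < x) (P : List ℝ)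
    (hP5 : P.length = 5) (hP : ∀ γ ∈ P, (lo : ℝ) ≤ K * γ ∧ γ < 1 ∧ x * ((lo : ℝ) + K) ≤ lo + K * γ) :
    SDEC x ((lo + K) * P.length) (sHub lo K P) := by
  obtain ⟨γ₁, γ₂, γ₃, γ₄, γ₅, rfl⟩ : ∃ a b c d e, P = [a, b, c, d, e] := by
    match P, hP5 with
    | [a, b, c, d, e], _ => exact ⟨a, b, c, d, e, rfl⟩
  obtain ⟨hγ₁, hγ₁1, hx₁⟩ := hP γ₁ (by simp)
  obtain ⟨hγ₂, hγ₂1, hx₂⟩ := hP γ₂ (by simp)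
  obtain ⟨hγ₃, hγ₃1, hx₃⟩ := hP γ₃ (by simp)
  obtain ⟨hγ₄, hγ₄1, hx₄⟩ := hP γ₄ (by simp)
  obtain ⟨hγ₅, hγ₅1, hx₅⟩ := hP γ₅ (by simp)
  have hlo1 : 1 ≤ lo := by omega
  have hloR : (1 : ℝ) ≤ lo := by exact_mod_cast hlo1
  have hKR : (lo : ℝ) < K := by exact_mod_cast hloK
  have hK4R : (K : ℝ) ≤ 4 * lo := by exact_mod_cast hK8
  have hK0 : (0 : ℝ) < K := by linarith
  have hγ₁0 : 0 ≤ γ₁ := by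
    by_contra hc; push Not at hc; have := mul_neg_of_pos_of_neg hK0 hc; linarith
  have hγ₂0 : 0 ≤ γ₂ := by
    by_contra hc; push Not at hc; have := mul_neg_of_pos_of_neg hK0 hc; linarith
  have hγ₃0 : 0 ≤ γ₃ := by
    by_contra hc; push Not at hc; have := mul_neg_of_pos_of_neg hK0 hc; linarith
  have hγ₄0 : 0 ≤ γ₄ := by
    by_contra hc; push Not at hc; have := mul_neg_of_pos_of_neg hK0 hc; linarith
  have hγ₅0 : 0 ≤ γ₅ := by
    by_contra hc; push Not at hc; have := mul_neg_of_pos_of_neg hK0 hc; linarith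
  have hx1 : x < 1 := by
    have : (lo : ℝ) + K * γ₁ < lo + K := by have := mul_lt_mul_of_pos_left hγ₁1 hK0; linarith
    by_contra hc; push Not at hc
    have : 1 * ((lo : ℝ) + K) ≤ x * (lo + K) := mul_le_mul_of_nonneg_right hc (by linarith)
    linarith
  have hP01 : ∀ γ ∈ [γ₁, γ₂, γ₃, γ₄, γ₅], 0 ≤ γ ∧ γ ≤ 1 := by
    intro γ hγ; simp only [List.mem_cons, List.mem_nil_iff, or_false] at hγ
    rcases hγ with rfl | rfl | rfl | rfl | rfl; exacts [⟨hγ₁0, hγ₁1.le⟩, ⟨hγ₂0, hγ₂1.le⟩, ⟨hγ₃0, hγ₃1.le⟩, ⟨hγ₄0, hγ₄1.le⟩, ⟨hγ₅0, hγ₅1.le⟩]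
  obtain ⟨l0, lM, l1, lmean⟩ := sHub_laws lo K [γ₁, γ₂, γ₃, γ₄, γ₅] hP01
  have eT0 : (([γ₁, γ₂, γ₃, γ₄, γ₅] : List ℝ).map (fun γ => (lo : ℝ) + K * γ)).sum = 5 * (lo : ℝ) + K * (γ₁ + γ₂ + γ₃ + γ₄ + γ₅) := by
    simp only [List.map_cons, List.map_nil, List.sum_cons, List.sum_nil]; ring
  rw [eT0] at lmean
  have elen : (lo + K) * ([γ₁, γ₂, γ₃, γ₄, γ₅] : List ℝ).length = 5 * lo + 5 * K := by show (lo + K) * 5 = 5 * lo + 5 * K; ring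
  -- the masses
  have z0 := sHub_five_mass0 lo K hloK γ₁ γ₂ γ₃ γ₄ γ₅ ⟨hγ₁0, hγ₁1⟩ ⟨hγ₂0, hγ₂1⟩ ⟨hγ₃0, hγ₃1⟩ ⟨hγ₄0, hγ₄1⟩ ⟨hγ₅0, hγ₅1⟩
  have z1 := sHub_five_mass1 lo K hloK γ₁ γ₂ γ₃ γ₄ γ₅ ⟨hγ₁0, hγ₁1⟩ ⟨hγ₂0, hγ₂1⟩ ⟨hγ₃0, hγ₃1⟩ ⟨hγ₄0, hγ₄1⟩ ⟨hγ₅0, hγ₅1⟩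
  have z2 := sHub_five_mass2 lo K hloK γ₁ γ₂ γ₃ γ₄ γ₅ ⟨hγ₁0, hγ₁1⟩ ⟨hγ₂0, hγ₂1⟩ ⟨hγ₃0, hγ₃1⟩ ⟨hγ₄0, hγ₄1⟩ ⟨hγ₅0, hγ₅1⟩
  have z3 := sHub_five_mass3 lo K hloK γ₁ γ₂ γ₃ γ₄ γ₅ ⟨hγ₁0, hγ₁1⟩ ⟨hγ₂0, hγ₂1⟩ ⟨hγ₃0, hγ₃1⟩ ⟨hγ₄0, hγ₄1⟩ ⟨hγ₅0, hγ₅1⟩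
  have z4 := sHub_five_mass4 lo K hloK γ₁ γ₂ γ₃ γ₄ γ₅ ⟨hγ₁0, hγ₁1⟩ ⟨hγ₂0, hγ₂1⟩ ⟨hγ₃0, hγ₃1⟩ ⟨hγ₄0, hγ₄1⟩ ⟨hγ₅0, hγ₅1⟩
  -- support: charged atoms are `5lo + Ks`
  have hsupp : ∀ k, sHub lo K [γ₁, γ₂, γ₃, γ₄, γ₅] k ≠ 0 → ∃ s, k = lo * 5 + K * s ∧ s ≤ 5 := by
    intro k hk
    have := (sHub_struct lo K hloK 0 le_rfl [γ₁, γ₂, γ₃, γ₄, γ₅] (fun γ hγ => ⟨(hP01 γ hγ).1, (hP01 γ hγ).2, by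
      rw [zero_mul]; exact (hP01 γ hγ).1⟩)).1 k hk
    simpa using this
  rw [elen] at lM l1 lmean ⊢
  set L : ℕ → ℝ := sHub lo K [γ₁, γ₂, γ₃, γ₄, γ₅] with hL
  clear_value L
  intro a ha0 ha1 j' hj'
  obtain ⟨g0, gM, g1⟩ := gate_laws (5 * lo + 5 * K) L a ha0.le ha1 l0 lM l1
  have gmean : ∑ h ∈ Finset.range (5 * lo + 5 * K + 1), (h : ℝ) * gate L a h = a * (5 * (lo : ℝ) + K * (γ₁ + γ₂ + γ₃ + γ₄ + γ₅)) := by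
    rw [sum_mul_gate, lmean]
  have gv : ∀ h, h ≠ 0 → gate L a h = a * L h := fun h hh => by rw [gate_apply, if_neg hh, mul_zero, add_zero]
  set T : ℝ := a * (5 * (lo : ℝ) + K * (γ₁ + γ₂ + γ₃ + γ₄ + γ₅)) with hT
  have hax0 : 0 < a * x := mul_pos ha0 hx0
  have hax1 : a * x < 1 := by have := mul_le_mul_of_nonneg_right ha1 hx0.le; linarith
  have hT0p : 0 < 5 * (lo : ℝ) + K * (γ₁ + γ₂ + γ₃ + γ₄ + γ₅) := by
    have := mul_nonneg hK0.le (show 0 ≤ γ₁ + γ₂ + γ₃ + γ₄ + γ₅ by linarith); linarith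
  have hT0 : 0 < T := mul_pos ha0 hT0p
  have hTle : T ≤ 5 * (lo : ℝ) + K * (γ₁ + γ₂ + γ₃ + γ₄ + γ₅) := by
    have := mul_le_mul_of_nonneg_right ha1 hT0p.le; rw [hT]; linarith
  have hTtop : T < 5 * (lo : ℝ) + 5 * K := by
    have : (K : ℝ) * (γ₁ + γ₂ + γ₃ + γ₄ + γ₅) < K * 5 := mul_lt_mul_of_pos_left (by linarith) hK0
    linarith
  have hta : a * x * ((5 * lo + 5 * K : ℕ) : ℝ) ≤ T := by
    have h2 : x * (5 * (lo : ℝ) + 5 * K) ≤ 5 * (lo : ℝ) + K * (γ₁ + γ₂ + γ₃ + γ₄ + γ₅) := by linarith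
    have h3 := mul_le_mul_of_nonneg_left h2 ha0.le
    push_cast; rw [hT]; linarith
  have v0 : gate L a (5 * lo) = a * ((1 - γ₁) * (1 - γ₂) * (1 - γ₃) * (1 - γ₄) * (1 - γ₅)) := by rw [gv _ (by omega), z0]
  have v1 : gate L a (5 * lo + K) = a * (γ₁ * (1 - γ₂) * (1 - γ₃) * (1 - γ₄) * (1 - γ₅) + γ₂ * (1 - γ₁) * (1 - γ₃) * (1 - γ₄) * (1 - γ₅)
      + γ₃ * (1 - γ₁) * (1 - γ₂) * (1 - γ₄) * (1 - γ₅) + γ₄ * (1 - γ₁) * (1 - γ₂) * (1 - γ₃) * (1 - γ₅)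
      + γ₅ * (1 - γ₁) * (1 - γ₂) * (1 - γ₃) * (1 - γ₄)) := by rw [gv _ (by omega), z1]
  have v2 : gate L a (5 * lo + 2 * K) = a * (γ₁ * γ₂ * (1 - γ₃) * (1 - γ₄) * (1 - γ₅) + γ₁ * γ₃ * (1 - γ₂) * (1 - γ₄) * (1 - γ₅) + γ₁ * γ₄ * (1 - γ₂) * (1 - γ₃) * (1 - γ₅)
      + γ₁ * γ₅ * (1 - γ₂) * (1 - γ₃) * (1 - γ₄) + γ₂ * γ₃ * (1 - γ₁) * (1 - γ₄) * (1 - γ₅) + γ₂ * γ₄ * (1 - γ₁) * (1 - γ₃) * (1 - γ₅)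
      + γ₂ * γ₅ * (1 - γ₁) * (1 - γ₃) * (1 - γ₄) + γ₃ * γ₄ * (1 - γ₁) * (1 - γ₂) * (1 - γ₅) + γ₃ * γ₅ * (1 - γ₁) * (1 - γ₂) * (1 - γ₄)
      + γ₄ * γ₅ * (1 - γ₁) * (1 - γ₂) * (1 - γ₃)) := by rw [gv _ (by omega), z2]
  have v3 : gate L a (5 * lo + 3 * K) = a * (γ₁ * γ₂ * γ₃ * (1 - γ₄) * (1 - γ₅) + γ₁ * γ₂ * γ₄ * (1 - γ₃) * (1 - γ₅) + γ₁ * γ₂ * γ₅ * (1 - γ₃) * (1 - γ₄)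
      + γ₁ * γ₃ * γ₄ * (1 - γ₂) * (1 - γ₅) + γ₁ * γ₃ * γ₅ * (1 - γ₂) * (1 - γ₄) + γ₁ * γ₄ * γ₅ * (1 - γ₂) * (1 - γ₃)
      + γ₂ * γ₃ * γ₄ * (1 - γ₁) * (1 - γ₅) + γ₂ * γ₃ * γ₅ * (1 - γ₁) * (1 - γ₄) + γ₂ * γ₄ * γ₅ * (1 - γ₁) * (1 - γ₃)
      + γ₃ * γ₄ * γ₅ * (1 - γ₁) * (1 - γ₂)) := by rw [gv _ (by omega), z3]
  have v4 : gate L a (5 * lo + 4 * K) = a * (γ₁ * γ₂ * γ₃ * γ₄ * (1 - γ₅) + γ₁ * γ₂ * γ₃ * γ₅ * (1 - γ₄) + γ₁ * γ₂ * γ₄ * γ₅ * (1 - γ₃) + γ₁ * γ₃ * γ₄ * γ₅ * (1 - γ₂)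
      + γ₂ * γ₃ * γ₄ * γ₅ * (1 - γ₁)) := by rw [gv _ (by omega), z4]
  -- a charged low is `5lo` or `5lo + K`
  have lowatom : ∀ l : ℕ, 1 ≤ l → 2 * (l : ℝ) < T → 0 < gate L a l → l = 5 * lo ∨ l = 5 * lo + K := by
    intro l hl hlT hpos
    have hLl : L l ≠ 0 := by
      intro h0; rw [gv l (by omega), h0, mul_zero] at hpos; exact lt_irrefl _ hpos
    obtain ⟨s, hs, _⟩ := hsupp l hLl
    rcases Nat.lt_or_ge s 2 with h2 | h2
    · interval_cases s
      · left; rw [hs]; ring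
      · right; rw [hs]; ring
    · exfalso
      have h1 : (K : ℝ) * 2 ≤ K * s := mul_le_mul_of_nonneg_left (by exact_mod_cast h2) hK0.le
      have hl' : (l : ℝ) = lo * 5 + K * s := by rw [hs]; push_cast; ring
      linarith
  -- the least gate: a 5-way symmetry reduction for the route lemmas
  obtain ⟨p, q, r, s, t, hperm, hpq, hpr, hps, hpt⟩ := exists_least_of_five γ₁ γ₂ γ₃ γ₄ γ₅
  have hpK : (lo : ℝ) ≤ K * p ∧ q < 1 ∧ r < 1 ∧ s < 1 ∧ t < 1 ∧ x * ((lo : ℝ) + K) ≤ lo + K * p := by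
    rcases hperm with ⟨rfl, rfl, rfl, rfl, rfl⟩ | ⟨rfl, rfl, rfl, rfl, rfl⟩ | ⟨rfl, rfl, rfl, rfl, rfl⟩ | ⟨rfl, rfl, rfl, rfl, rfl⟩ |
      ⟨rfl, rfl, rfl, rfl, rfl⟩
    · exact ⟨hγ₁, hγ₂1, hγ₃1, hγ₄1, hγ₅1, hx₁⟩
    · exact ⟨hγ₂, hγ₁1, hγ₃1, hγ₄1, hγ₅1, hx₂⟩
    · exact ⟨hγ₃, hγ₁1, hγ₂1, hγ₄1, hγ₅1, hx₃⟩
    · exact ⟨hγ₄, hγ₁1, hγ₂1, hγ₃1, hγ₅1, hx₄⟩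
    · exact ⟨hγ₅, hγ₁1, hγ₂1, hγ₃1, hγ₄1, hx₅⟩
  obtain ⟨hp, hq1, hr1, hs1, ht1, hxp⟩ := hpK
  have hTp : T = a * (5 * (lo : ℝ) + K * (p + q + r + s + t)) := by
    rcases hperm with ⟨rfl, rfl, rfl, rfl, rfl⟩ | ⟨rfl, rfl, rfl, rfl, rfl⟩ | ⟨rfl, rfl, rfl, rfl, rfl⟩ | ⟨rfl, rfl, rfl, rfl, rfl⟩ |
      ⟨rfl, rfl, rfl, rfl, rfl⟩ <;> rw [hT] <;> ring
  have w0 : gate L a (5 * lo) = a * ((1 - p) * (1 - q) * (1 - r) * (1 - s) * (1 - t)) := by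
    rcases hperm with ⟨rfl, rfl, rfl, rfl, rfl⟩ | ⟨rfl, rfl, rfl, rfl, rfl⟩ | ⟨rfl, rfl, rfl, rfl, rfl⟩ | ⟨rfl, rfl, rfl, rfl, rfl⟩ |
      ⟨rfl, rfl, rfl, rfl, rfl⟩ <;> rw [v0] <;> ring
  have w1 : gate L a (5 * lo + K) = a * (p * (1 - q) * (1 - r) * (1 - s) * (1 - t) + q * (1 - p) * (1 - r) * (1 - s) * (1 - t) + r * (1 - p) * (1 - q) * (1 - s) * (1 - t)
      + s * (1 - p) * (1 - q) * (1 - r) * (1 - t) + t * (1 - p) * (1 - q) * (1 - r) * (1 - s)) := by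
    rcases hperm with ⟨rfl, rfl, rfl, rfl, rfl⟩ | ⟨rfl, rfl, rfl, rfl, rfl⟩ | ⟨rfl, rfl, rfl, rfl, rfl⟩ | ⟨rfl, rfl, rfl, rfl, rfl⟩ |
      ⟨rfl, rfl, rfl, rfl, rfl⟩ <;> rw [v1] <;> ring
  have w2 : gate L a (5 * lo + 2 * K) = a * (p * q * (1 - r) * (1 - s) * (1 - t) + p * r * (1 - q) * (1 - s) * (1 - t) + p * s * (1 - q) * (1 - r) * (1 - t)
      + p * t * (1 - q) * (1 - r) * (1 - s) + q * r * (1 - p) * (1 - s) * (1 - t) + q * s * (1 - p) * (1 - r) * (1 - t)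
      + q * t * (1 - p) * (1 - r) * (1 - s) + r * s * (1 - p) * (1 - q) * (1 - t) + r * t * (1 - p) * (1 - q) * (1 - s)
      + s * t * (1 - p) * (1 - q) * (1 - r)) := by
    rcases hperm with ⟨rfl, rfl, rfl, rfl, rfl⟩ | ⟨rfl, rfl, rfl, rfl, rfl⟩ | ⟨rfl, rfl, rfl, rfl, rfl⟩ | ⟨rfl, rfl, rfl, rfl, rfl⟩ |
      ⟨rfl, rfl, rfl, rfl, rfl⟩ <;> rw [v2] <;> ring
  have w3 : gate L a (5 * lo + 3 * K) = a * (p * q * r * (1 - s) * (1 - t) + p * q * s * (1 - r) * (1 - t) + p * q * t * (1 - r) * (1 - s) + p * r * s * (1 - q) * (1 - t)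
      + p * r * t * (1 - q) * (1 - s) + p * s * t * (1 - q) * (1 - r) + q * r * s * (1 - p) * (1 - t) + q * r * t * (1 - p) * (1 - s)
      + q * s * t * (1 - p) * (1 - r) + r * s * t * (1 - p) * (1 - q)) := by
    rcases hperm with ⟨rfl, rfl, rfl, rfl, rfl⟩ | ⟨rfl, rfl, rfl, rfl, rfl⟩ | ⟨rfl, rfl, rfl, rfl, rfl⟩ | ⟨rfl, rfl, rfl, rfl, rfl⟩ |
      ⟨rfl, rfl, rfl, rfl, rfl⟩ <;> rw [v3] <;> ring
  have w4 : gate L a (5 * lo + 4 * K) = a * (p * q * r * s * (1 - t) + p * q * r * t * (1 - s) + p * q * s * t * (1 - r) + p * r * s * t * (1 - q) + q * r * s * t * (1 - p)) := by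
    rcases hperm with ⟨rfl, rfl, rfl, rfl, rfl⟩ | ⟨rfl, rfl, rfl, rfl, rfl⟩ | ⟨rfl, rfl, rfl, rfl, rfl⟩ | ⟨rfl, rfl, rfl, rfl, rfl⟩ |
      ⟨rfl, rfl, rfl, rfl, rfl⟩ <;> rw [v4] <;> ring
  clear hperm
  have c5lo : ((5 * lo : ℕ) : ℝ) = 5 * (lo : ℝ) := by push_cast; ring
  -- the budget is nonnegative; a cost-safe route from `5lo` fits in the budget term of `5lo`
  have budnn : ∀ l ∈ Finset.range (5 * lo + 5 * K + 1), 0 ≤ (if (1 ≤ l ∧ (l : ℝ) < T) then gate L a l * (T - l) else 0) := by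
    intro l _; split_ifs with hc
    · exact mul_nonneg (g0 l) (by linarith [hc.2])
    · exact le_rfl
  have budlo : ∀ tt : ℕ, 10 * (lo : ℝ) < T → 5 * lo < tt → T < ((5 * lo : ℕ) : ℝ) + (tt : ℝ) →
      (a * x) * ((tt : ℝ) - ((5 * lo : ℕ) : ℝ)) ≤ T - ((5 * lo : ℕ) : ℝ) →
      (if T < (tt : ℝ) then ((tt : ℝ) - T) * (freeRate (a * x) T (5 * lo) tt * gate L a (5 * lo)) else 0)
        ≤ ∑ l ∈ Finset.range (5 * lo + 5 * K + 1), (if (1 ≤ l ∧ (l : ℝ) < T) then gate L a l * (T - l) else 0) := by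
    intro tt hT10 htlo hTt hsafe
    have hterm : (if T < (tt : ℝ) then ((tt : ℝ) - T) * (freeRate (a * x) T (5 * lo) tt * gate L a (5 * lo)) else 0)
        ≤ gate L a (5 * lo) * (T - ((5 * lo : ℕ) : ℝ)) := by
      split_ifs with hc
      · have hr := freeRate_torque_le (a * x) T (5 * lo) tt hax0 hax1 (by rw [c5lo]; linarith) htlo hTt hsafe
        have := mul_le_mul_of_nonneg_right hr (g0 (5 * lo))
        linarith
      · exact mul_nonneg (g0 _) (by rw [c5lo]; linarith)
    refine hterm.trans ?_
    have hmem : 5 * lo ∈ Finset.range (5 * lo + 5 * K + 1) := Finset.mem_range.2 (by omega)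
    have h1 := Finset.single_le_sum budnn hmem
    rw [if_pos ⟨by omega, by rw [c5lo]; linarith⟩] at h1
    exact h1
  by_cases hT10 : 10 * (lo : ℝ) < T
  · by_cases hT102 : T ≤ 10 * (lo : ℝ) + 2 * K
    · -- ONE positive low `5lo`: whole to `tt ∈ {5lo+2K, 5lo+3K}`, cost-safe
      obtain ⟨tt, htt, hTt, hcapt, hsafe⟩ := quintHub_routeOne lo K hloK hK2 hK8 (gate L a) (a * x) T a p q r s t x g0 hpq hpr hps hpt hp hq1 hr1 hs1
        ht1 hx0 hxp ha0 ha1 rfl hTp hT10 hT102 w0 w2 w3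
      have httop : tt ≤ 5 * lo + 5 * K := by rcases htt with rfl | rfl <;> omega
      have htmem : tt ∈ Finset.range (5 * lo + 5 * K + 1) := Finset.mem_range.2 (by omega)
      have htlo : 5 * lo < tt := by rcases htt with rfl | rfl <;> omega
      have colt : ∀ h : ℕ, ∑ l ∈ Finset.range (5 * lo + 5 * K + 1), freeRate (a * x) T l h * (if l = 5 * lo ∧ h = tt then gate L a (5 * lo) else 0)
          = if h = tt then freeRate (a * x) T (5 * lo) tt * gate L a (5 * lo) else 0 := by
        intro h
        rw [Finset.sum_eq_single_of_mem (5 * lo) (Finset.mem_range.2 (by omega)) (fun l _ hl => by simp [hl])]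
        by_cases hh : h = tt
        · subst hh; simp
        · simp [hh]
      refine decAt_all_of_torqueCost (a * x) (5 * lo + 5 * K) (gate L a) T
        (fun l h => if l = 5 * lo ∧ h = tt then gate L a (5 * lo) else 0) hax0 hax1 g0 gM g1 gmean hT0 hta ?_ ?_ ?_ ?_ ?_ j' hj'
      · intro l h; split_ifs
        · exact g0 _
        · exact le_rfl
      · intro l h hlh
        split_ifs at hlh with hc
        · obtain ⟨rfl, rfl⟩ := hc
          exact ⟨by omega, by rw [c5lo]; linarith, htlo, httop, hTt⟩
        · exact absurd hlh (lt_irrefl _)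
      · intro l hl hlow
        by_cases hl' : l = 5 * lo
        · subst hl'
          rw [Finset.sum_eq_single_of_mem tt htmem (fun h _ hh => by simp [hh])]; simp
        · rw [Finset.sum_eq_zero fun h _ => by simp [hl']]
          rcases (g0 l).eq_or_lt with h0 | hpos
          · exact h0
          · exfalso
            rcases lowatom l hl hlow hpos with h | h
            · exact hl' h
            · subst h; push_cast at hlow; linarith
      · intro h _
        rw [colt h]
        split_ifs with hh
        · subst hh; exact hcapt
        · exact g0 h
      · rw [Finset.sum_eq_single_of_mem tt htmem (fun h _ hh => by rw [colt h, if_neg hh, mul_zero, ite_self])]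
        rw [colt tt, if_pos rfl]
        exact budlo tt hT10 htlo hTt hsafe
    · -- TWO positive lows `5lo → 5lo+4K` (cost-safe), `5lo+K → 5lo+3K` (near)
      push Not at hT102
      obtain ⟨hcap0, hsafe0, hcap1⟩ := quintHub_routeTwo lo K hloK hK2 hK8 (gate L a) (a * x) T a p q r s t x g0 hpq hpr hps hpt hp hq1 hr1 hs1 ht1
        hx0 hxp ha0 ha1 rfl hTp hT102 w0 w1 w3 w4
      set M : ℕ := 5 * lo + 5 * K with hM
      set f : ℕ → ℕ → ℝ := fun l h => if (l = 5 * lo ∧ h = 5 * lo + 4 * K) ∨ (l = 5 * lo + K ∧ h = 5 * lo + 3 * K) then gate L a l else 0 with hf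
      have hne1 : 5 * lo + 4 * K ≠ 5 * lo + 3 * K := by omega
      have f0v : ∀ h, f (5 * lo) h = if h = 5 * lo + 4 * K then gate L a (5 * lo) else 0 := by
        intro h; rw [hf]; dsimp only
        by_cases hh : h = 5 * lo + 4 * K
        · rw [if_pos (Or.inl ⟨rfl, hh⟩), if_pos hh]
        · rw [if_neg (by rintro (⟨_, h1⟩ | ⟨h2, _⟩) <;> omega), if_neg hh]
      have f1v : ∀ h, f (5 * lo + K) h = if h = 5 * lo + 3 * K then gate L a (5 * lo + K) else 0 := by
        intro h; rw [hf]; dsimp only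
        by_cases hh : h = 5 * lo + 3 * K
        · rw [if_pos (Or.inr ⟨rfl, hh⟩), if_pos hh]
        · rw [if_neg (by rintro (⟨h1, _⟩ | ⟨_, h2⟩) <;> omega), if_neg hh]
      have fne : ∀ l h, l ≠ 5 * lo → l ≠ 5 * lo + K → f l h = 0 := by
        intro l h h1 h2; rw [hf]; dsimp only; rw [if_neg (by rintro (⟨h3, _⟩ | ⟨h4, _⟩) <;> omega)]
      have col : ∀ h, ∑ l ∈ Finset.range (M + 1), freeRate (a * x) T l h * f l h
          = freeRate (a * x) T (5 * lo) h * f (5 * lo) h + freeRate (a * x) T (5 * lo + K) h * f (5 * lo + K) h := by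
        intro h
        rw [Finset.sum_eq_add_of_mem (5 * lo) (5 * lo + K) (Finset.mem_range.2 (by omega)) (Finset.mem_range.2 (by omega)) (by omega)
          (fun l _ hl => by rw [fne l h hl.1 hl.2, mul_zero])]
      have cMR : ((M : ℕ) : ℝ) = 5 * (lo : ℝ) + 5 * K := by rw [hM]; push_cast; ring
      refine decAt_all_of_torqueCost (a * x) M (gate L a) T f hax0 hax1 g0 gM g1 gmean hT0 hta ?_ ?_ ?_ ?_ ?_ j' hj'
      · intro l h; rw [hf]; dsimp only; split_ifs
        · exact g0 _
        · exact le_rfl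
      · intro l h hlh
        rw [hf] at hlh; dsimp only at hlh
        split_ifs at hlh with hc
        · rcases hc with ⟨rfl, rfl⟩ | ⟨rfl, rfl⟩
          · exact ⟨by omega, by push_cast; linarith, by omega, by omega, by push_cast; linarith⟩
          · exact ⟨by omega, by push_cast; linarith, by omega, by omega, by push_cast; linarith⟩
        · exact absurd hlh (lt_irrefl _)
      · intro l hl hlow
        by_cases hl0 : l = 5 * lo
        · subst hl0
          rw [Finset.sum_congr rfl fun h _ => f0v h, Finset.sum_ite_eq' (Finset.range (M + 1)), if_pos (Finset.mem_range.2 (by omega))]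
        by_cases hl1 : l = 5 * lo + K
        · subst hl1
          rw [Finset.sum_congr rfl fun h _ => f1v h, Finset.sum_ite_eq' (Finset.range (M + 1)), if_pos (Finset.mem_range.2 (by omega))]
        rw [Finset.sum_eq_zero fun h _ => fne l h hl0 hl1]
        rcases (g0 l).eq_or_lt with h0 | hpos
        · exact h0
        · rcases lowatom l hl hlow hpos with h | h
          · exact absurd h hl0
          · exact absurd h hl1
      · intro h _
        rw [col h, f0v h, f1v h]
        by_cases hh4 : h = 5 * lo + 4 * K
        · subst hh4; rw [if_pos rfl, if_neg hne1, mul_zero, add_zero]; exact hcap0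
        by_cases hh3 : h = 5 * lo + 3 * K
        · subst hh3; rw [if_neg (Ne.symm hne1), if_pos rfl, mul_zero, zero_add]; exact hcap1
        rw [if_neg hh4, if_neg hh3, mul_zero, mul_zero, add_zero]; exact g0 h
      · -- the column `5lo+3K` lies below `T`; the column `5lo+4K` is cost-safe
        have hcolval : ∀ h ∈ Finset.range (M + 1),
            (if T < (h : ℝ) then ((h : ℝ) - T) * ∑ l ∈ Finset.range (M + 1), freeRate (a * x) T l h * f l h else 0)
              = (if h = 5 * lo + 4 * K then
                  (if T < (h : ℝ) then ((h : ℝ) - T) * (freeRate (a * x) T (5 * lo) (5 * lo + 4 * K) * gate L a (5 * lo)) else 0) else 0) := by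
          intro h _
          by_cases hh4 : h = 5 * lo + 4 * K
          · subst hh4; rw [if_pos rfl, col, f0v, f1v, if_pos rfl, if_neg hne1, mul_zero, add_zero]
          · rw [if_neg hh4]
            by_cases hTh : T < (h : ℝ)
            · rw [if_pos hTh, col h, f0v h, f1v h, if_neg hh4]
              have hh3 : h ≠ 5 * lo + 3 * K := by rintro rfl; push_cast at hTh; linarith
              rw [if_neg hh3]; ring
            · rw [if_neg hTh]
        rw [Finset.sum_congr rfl hcolval, Finset.sum_ite_eq' (Finset.range (M + 1)), if_pos (Finset.mem_range.2 (by omega))]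
        exact budlo (5 * lo + 4 * K) hT10 (by omega) (by push_cast; linarith) hsafe0
  · -- no positive low atom
    refine decAt_all_of_lowCeiling (a * x) (5 * lo + 5 * K) (gate L a) T hax0 hax1 g0 gM g1 gmean hT0 hta ?_ j' hj'
    intro l hl hlow hpos
    exfalso
    rcases lowatom l hl hlow hpos with h | h <;> subst h <;> push_cast at hlow <;> linarith

/-- **THE WIDTH-5 HUB OF EVERY SHAPE `lo < K ≤ 4lo` IS SDEC** at every gate `γᵢ ≥ lo/K` and every affordable floor (gen 32's `sdec_sHub_wide` for
`K ≤ 2lo`, `sdec_sHub_five_long` for `2lo < K ≤ 4lo`). [this work] -/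
theorem sdec_sHub_five_upTo4 (lo K : ℕ) (hloK : lo < K) (hK8 : K ≤ 4 * lo) {x : ℝ} (hx0 : 0 < x) (P : List ℝ) (hP5 : P.length = 5)
    (hP : ∀ γ ∈ P, (lo : ℝ) ≤ K * γ ∧ γ < 1 ∧ x * ((lo : ℝ) + K) ≤ lo + K * γ) :
    SDEC x ((lo + K) * P.length) (sHub lo K P) := by
  rcases le_or_gt K (2 * lo) with h | h
  · exact sdec_sHub_wide lo K hloK h hx0 P (by rw [hP5]; norm_num) hP
  · exact sdec_sHub_five_long lo K hloK h hK8 hx0 P hP5 hP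

/-- **THE HUBS OF WIDTHS 2, 3, 4 AND 5 OF EVERY SHAPE `lo < K ≤ 4lo` ARE SDEC** at every gate `γᵢ ≥ lo/K` and every affordable floor
(`sdec_sHub_upToFour_upTo4`, `sdec_sHub_five_upTo4`). [this work] -/
theorem sdec_sHub_upToFive_upTo4 (lo K : ℕ) (hloK : lo < K) (hK8 : K ≤ 4 * lo) {x : ℝ} (hx0 : 0 < x) (P : List ℝ)
    (hP25 : 2 ≤ P.length ∧ P.length ≤ 5) (hP : ∀ γ ∈ P, (lo : ℝ) ≤ K * γ ∧ γ < 1 ∧ x * ((lo : ℝ) + K) ≤ lo + K * γ) :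
    SDEC x ((lo + K) * P.length) (sHub lo K P) := by
  rcases hP25 with ⟨h2, h5⟩
  rcases Nat.lt_or_ge P.length 5 with h | h
  · exact sdec_sHub_upToFour_upTo4 lo K hloK hK8 hx0 P ⟨h2, by omega⟩ hP
  · exact sdec_sHub_five_upTo4 lo K hloK hK8 hx0 P (by omega) hP

end LawDec
end Quant
end Summit.CriticalPhenomena.PercolationContinuityZ3.Theorems
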